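import Summits.CriticalPhenomena.PercolationContinuityZ3.Theorems.PercNearOneGluingNoHeavyLowerTailSahiThreeCopy

/-!
# `NoHeavyLowerTail` (crux stmt-CriticalPhenomena-4575), Sahi programme: **THREE-COPY HARRIS FOR MONGE KERNELS**
# — `Σ_{arr b} G(x,y)·r(z) ≤ Σ_{arr b} G(x,x)·r(z)` for every kernel `G` with isotone differences on comparable pairs
# and every nonnegative spectator `r`, coefficientwise (the "2-copy engine" of the 3C-SAHI certificate programme)

Support file (Sahi cell, seat `prim-sahi-p1`, generation 55; `--supports stmt-CriticalPhenomena-4575`); companion of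
`…SahiThreeCopy` (generation 53), whose three-copy Harris inequality `N3_le_N3_mul` (`N_b(f;g;r) ≤ N_b(fg;1;r)` for
nonnegative monotone `f, g`) is the RANK-ONE case `G(x,y) = f(x)g(y)` of the theorem proved here.  Requested in the cell's
generation-54 hand-over (memo FROM-prim-sahi-p1-gen54 §3g, successor step (2a): "the poset-Monge / Harris-with-spectator kernel
lemma on slices — it is the 2-copy engine every certificate here uses").

THE STATEMENT.  A kernel `G : {0,1}^d × {0,1}^d → ℝ` is MONGE (`IsMonge G`) when it has isotone differences on comparable
pairs: `G(x,y') + G(x',y) ≤ G(x,y) + G(x',y')` whenever `x ≤ x'` and `y ≤ y'`.  Examples: `f(x)g(y)` with `f, g` both monotone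
or both antitone (any signs), `−f(x)g(y)` with one monotone and one antitone, `−c(x ∨ y)`-type kernels, sums of these, and —
the case the certificate LPs use — kernels `G(x,y) = M[κ(x), κ'(y)]` pulled back from a Monge matrix `M` on a product of chains
along monotone "cell" maps `κ, κ'`.  The KERNEL TWO-COPY FUNCTIONAL with spectator is `NK_b(G; r) = Σ_{(x,y,z) arrangement of b}
G(x,y)·r(z)` (so `N_b(f;g;r) = NK_b(f⊗g; r)` and `N_b(fg;1;r) = NK_b(diag(f⊗g); r)` with `diag G (x,y) = G(x,x)`).

* `NK_le_NK_diagK` — **for every Monge `G`, every `r ≥ 0`, every `d` and every profile `b`: `NK_b(G; r) ≤ NK_b(diag G; r)`.**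
  Proof: induction on `d` through the slice recursion `NK_cons` (all four kernel sections `G^{ε₁ε₂}` of a Monge kernel are Monge;
  the slice step is the single Monge inequality `G(1x,0x) + G(0x,1x) ≤ G(1x,1x) + G(0x,0x)` on the diagonal).  No sign or
  monotonicity hypothesis on `G` itself is needed.  Law-level shadow (sum against `Π q_i^{b_i}(1−q_i)^{3−b_i}`): for `X, Y`
  independent with the same product law on `{0,1}^d`, `E G(X,Y) ≤ E G(X,X)` — Chebyshev's sum inequality coordinate by
  coordinate; here it holds arrangement class by arrangement class with a free spectator copy.
* Corollaries: `N3_le_N3_mul_of_monotone` (three-copy Harris WITHOUT the nonnegativity hypotheses on `f, g`),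
  `N3_le_N3_mul_of_antitone` (two antitone functions), `N3_mul_le_N3_of_monotone_antitone` (the reversed inequality for a
  monotone/antitone pair), `NK_le_NK_diagK'` (diagonal taken in the second variable), and the symmetric form
  `two_NK_le` : `2·NK_b(G;r) ≤ NK_b(diag G; r) + NK_b(diag' G; r)`.
Everything is bookkeeping plus one induction; nothing conjectural is used or asserted.  [this work]
-/

namespace Summit.CriticalPhenomena.PercolationContinuityZ3.Theorems.SahiThreeCopy

open Finset Function Literature.Combinatorics.Sahi2008
open scoped BigOperators

noncomputable section

variable {d : ℕ}

/-! ### §1 The kernel two-copy functional with spectator -/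

/-- The KERNEL TWO-COPY FUNCTIONAL with spectator: `NK_b(G; r) = Σ_{(x,y,z) arrangement of b} G(x,y)·r(z)`. [this work] -/
def NK (b : Fin d → ℕ) (G : Pt d → Pt d → ℝ) (r : Pt d → ℝ) : ℝ :=
  ∑ x : Pt d, ∑ y : Pt d, ∑ z : Pt d, if IsArr b x y z then G x y * r z else 0

/-- The diagonal of a kernel, as a kernel constant in the second variable: `diag G (x,y) = G(x,x)`. [this work] -/
def diagK (G : Pt d → Pt d → ℝ) : Pt d → Pt d → ℝ := fun x _ => G x x

/-- The diagonal of a kernel, as a kernel constant in the first variable: `diag' G (x,y) = G(y,y)`. [this work] -/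
def diagK' (G : Pt d → Pt d → ℝ) : Pt d → Pt d → ℝ := fun _ y => G y y

/-- The transpose of a kernel. [this work] -/
def transK (G : Pt d → Pt d → ℝ) : Pt d → Pt d → ℝ := fun x y => G y x

/-- A kernel is MONGE when it has isotone differences on comparable pairs:
`G(x,y') + G(x',y) ≤ G(x,y) + G(x',y')` for `x ≤ x'`, `y ≤ y'`. [this work] -/
def IsMonge (G : Pt d → Pt d → ℝ) : Prop :=
  ∀ ⦃x x' : Pt d⦄, x ≤ x' → ∀ ⦃y y' : Pt d⦄, y ≤ y' → G x y' + G x' y ≤ G x y + G x' y'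

/-- `N_b(f;g;r) = NK_b(f⊗g; r)`. [this work] -/
theorem N3_eq_NK (b : Fin d → ℕ) (f g r : Pt d → ℝ) : N3 b f g r = NK b (fun x y => f x * g y) r := rfl

/-- `N_b(fg;1;r) = NK_b(diag(f⊗g); r)`. [this work] -/
theorem N3_mul_one_eq_NK (b : Fin d → ℕ) (f g r : Pt d → ℝ) :
    N3 b (f * g) 1 r = NK b (diagK fun x y => f x * g y) r := by
  unfold N3 NK diagK
  refine sum_congr rfl fun x _ => sum_congr rfl fun y _ => sum_congr rfl fun z _ => ?_
  simp only [Pi.mul_apply, Pi.one_apply, mul_one]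

/-- `NK` is additive in the kernel. [this work] -/
theorem NK_add (b : Fin d → ℕ) (G G' : Pt d → Pt d → ℝ) (r : Pt d → ℝ) :
    NK b (G + G') r = NK b G r + NK b G' r := by
  unfold NK
  simp only [← sum_add_distrib]
  refine sum_congr rfl fun x _ => sum_congr rfl fun y _ => sum_congr rfl fun z _ => ?_
  split_ifs <;> simp [add_mul]

/-- `NK` is monotone in the kernel for a nonnegative spectator. [this work] -/
theorem NK_mono (b : Fin d → ℕ) {G G' : Pt d → Pt d → ℝ} {r : Pt d → ℝ} (hGG' : ∀ x y, G x y ≤ G' x y)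
    (hr : ∀ z, 0 ≤ r z) : NK b G r ≤ NK b G' r := by
  unfold NK
  refine sum_le_sum fun x _ => sum_le_sum fun y _ => sum_le_sum fun z _ => ?_
  split_ifs
  · exact mul_le_mul_of_nonneg_right (hGG' x y) (hr z)
  · exact le_rfl

/-- `NK` of the transposed kernel (swap the first two copies). [this work] -/
theorem NK_transK (b : Fin d → ℕ) (G : Pt d → Pt d → ℝ) (r : Pt d → ℝ) : NK b (transK G) r = NK b G r := by
  unfold NK transK
  rw [sum_comm]
  refine sum_congr rfl fun y _ => sum_congr rfl fun x _ => sum_congr rfl fun z _ => ?_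
  have : IsArr b y x z ↔ IsArr b x y z := by
    unfold IsArr; exact forall_congr' fun i => by constructor <;> intro h <;> omega
  simp only [this]

/-- `diag'` is the transpose of `diag ∘ transpose`. [this work] -/
theorem diagK'_eq (G : Pt d → Pt d → ℝ) : diagK' G = transK (diagK (transK G)) := rfl

/-- The transpose of a Monge kernel is Monge. [this work] -/
theorem isMonge_transK {G : Pt d → Pt d → ℝ} (hG : IsMonge G) : IsMonge (transK G) := by
  intro x x' hx y y' hy
  have := hG hy hx
  unfold transK
  linarith

/-- In dimension `0` every profile has exactly one arrangement. [this work] -/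
theorem NK_dim_zero (b : Fin 0 → ℕ) (G : Pt 0 → Pt 0 → ℝ) (r : Pt 0 → ℝ) :
    NK b G r = G (fun i => Fin.elim0 i) (fun i => Fin.elim0 i) * r (fun i => Fin.elim0 i) := by
  have key : ∀ x y z : Pt 0, (if IsArr b x y z then G x y * r z else 0) =
      G (fun i => Fin.elim0 i) (fun i => Fin.elim0 i) * r (fun i => Fin.elim0 i) := by
    intro x y z
    have hx : x = fun i => Fin.elim0 i := Subsingleton.elim _ _
    have hy : y = fun i => Fin.elim0 i := Subsingleton.elim _ _
    have hz : z = fun i => Fin.elim0 i := Subsingleton.elim _ _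
    subst hx hy hz
    exact if_pos (fun i => Fin.elim0 i)
  unfold NK
  rw [Fintype.sum_unique, Fintype.sum_unique, Fintype.sum_unique]
  exact key _ _ _

/-! ### §2 Kernel sections and the slice recursion -/

/-- The section `G^{ε₁ε₂}(x,y) = G((ε₁,x),(ε₂,y))` of a kernel on the `(d+1)`-cube along coordinate `0`. [this work] -/
def secK (G : Pt (d + 1) → Pt (d + 1) → ℝ) (ε₁ ε₂ : Bool) : Pt d → Pt d → ℝ :=
  fun x y => G (Fin.cons ε₁ x) (Fin.cons ε₂ y)

/-- Sections of a Monge kernel are Monge. [this work] -/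
theorem isMonge_secK {G : Pt (d + 1) → Pt (d + 1) → ℝ} (hG : IsMonge G) (ε₁ ε₂ : Bool) : IsMonge (secK G ε₁ ε₂) :=
  fun _ _ hx _ _ hy => hG (Fin.cons_le_cons.2 ⟨le_rfl, hx⟩) (Fin.cons_le_cons.2 ⟨le_rfl, hy⟩)

/-- Sections of the diagonal kernel: `(diag G)^{ε₁ε₂} = diag (G^{ε₁ε₁})`. [this work] -/
theorem secK_diagK (G : Pt (d + 1) → Pt (d + 1) → ℝ) (ε₁ ε₂ : Bool) :
    secK (diagK G) ε₁ ε₂ = diagK (secK G ε₁ ε₁) := rfl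

/-- **The slice step**: on the diagonal a Monge kernel satisfies
`G(1x,0x) + G(0x,1x) ≤ G(1x,1x) + G(0x,0x)`, i.e. `diag G^{10} + diag G^{01} ≤ diag G^{11} + diag G^{00}`. [this work] -/
theorem diagK_secK_cross_le {G : Pt (d + 1) → Pt (d + 1) → ℝ} (hG : IsMonge G) (x y : Pt d) :
    diagK (secK G true false) x y + diagK (secK G false true) x y ≤
      diagK (secK G true true) x y + diagK (secK G false false) x y := by
  have h01 : (Fin.cons false x : Pt (d + 1)) ≤ Fin.cons true x := Fin.cons_le_cons.2 ⟨Bool.false_le _, le_rfl⟩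
  have := hG h01 h01
  unfold diagK secK
  linarith

/-- **Slice recursion for `NK`**: `NK_{(k,b)}(G; r) = Σ_{ε₁+ε₂+ε₃ = k} NK_b(G^{ε₁ε₂}; r^{ε₃})`. [this work] -/
theorem NK_cons (k : ℕ) (b : Fin d → ℕ) (G : Pt (d + 1) → Pt (d + 1) → ℝ) (r : Pt (d + 1) → ℝ) :
    NK (Fin.cons k b : Fin (d + 1) → ℕ) G r =
      ∑ ε₁ : Bool, ∑ ε₂ : Bool, ∑ ε₃ : Bool,
        if ε₁.toNat + ε₂.toNat + ε₃.toNat = k then NK b (secK G ε₁ ε₂) (sec r ε₃) else 0 := by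
  unfold NK secK sec
  simp only [sum_pt_succ, ite_isArr_cons]
  refine (sum6_comm _).trans ?_
  refine sum_congr rfl fun ε₁ _ => sum_congr rfl fun ε₂ _ => sum_congr rfl fun ε₃ _ => ?_
  by_cases hc : ε₁.toNat + ε₂.toNat + ε₃.toNat = k
  · simp only [hc, true_and, if_true]
  · simp only [hc, false_and, if_false, sum_const_zero]

/-- Slice `k = 0`. [this work] -/
theorem NK_cons_zero (b : Fin d → ℕ) (G : Pt (d + 1) → Pt (d + 1) → ℝ) (r : Pt (d + 1) → ℝ) :
    NK (Fin.cons 0 b : Fin (d + 1) → ℕ) G r = NK b (secK G false false) (sec r false) := by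
  rw [NK_cons]
  simp only [Fintype.sum_bool, Bool.toNat_true, Bool.toNat_false]
  norm_num

/-- Slice `k = 1`. [this work] -/
theorem NK_cons_one (b : Fin d → ℕ) (G : Pt (d + 1) → Pt (d + 1) → ℝ) (r : Pt (d + 1) → ℝ) :
    NK (Fin.cons 1 b : Fin (d + 1) → ℕ) G r =
      NK b (secK G true false) (sec r false) + NK b (secK G false true) (sec r false) +
        NK b (secK G false false) (sec r true) := by
  rw [NK_cons]
  simp only [Fintype.sum_bool, Bool.toNat_true, Bool.toNat_false]
  norm_num
  ring

/-- Slice `k = 2`. [this work] -/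
theorem NK_cons_two (b : Fin d → ℕ) (G : Pt (d + 1) → Pt (d + 1) → ℝ) (r : Pt (d + 1) → ℝ) :
    NK (Fin.cons 2 b : Fin (d + 1) → ℕ) G r =
      NK b (secK G false true) (sec r true) + NK b (secK G true false) (sec r true) +
        NK b (secK G true true) (sec r false) := by
  rw [NK_cons]
  simp only [Fintype.sum_bool, Bool.toNat_true, Bool.toNat_false]
  norm_num
  ring

/-- Slice `k = 3`. [this work] -/
theorem NK_cons_three (b : Fin d → ℕ) (G : Pt (d + 1) → Pt (d + 1) → ℝ) (r : Pt (d + 1) → ℝ) :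
    NK (Fin.cons 3 b : Fin (d + 1) → ℕ) G r = NK b (secK G true true) (sec r true) := by
  rw [NK_cons]
  simp only [Fintype.sum_bool, Bool.toNat_true, Bool.toNat_false]
  norm_num

/-- Slices `k ≥ 4` are empty. [this work] -/
theorem NK_cons_add_four (k : ℕ) (b : Fin d → ℕ) (G : Pt (d + 1) → Pt (d + 1) → ℝ) (r : Pt (d + 1) → ℝ) :
    NK (Fin.cons (k + 4) b : Fin (d + 1) → ℕ) G r = 0 := by
  rw [NK_cons]
  refine sum_eq_zero fun ε₁ _ => sum_eq_zero fun ε₂ _ => sum_eq_zero fun ε₃ _ => ?_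
  have : ε₁.toNat + ε₂.toNat + ε₃.toNat ≠ k + 4 := by
    have h1 := Bool.toNat_le ε₁; have h2 := Bool.toNat_le ε₂; have h3 := Bool.toNat_le ε₃; omega
  rw [if_neg this]

/-! ### §3 Kernel three-copy Harris -/

/-- **Three-copy Harris for Monge kernels.**  For every kernel `G` on `{0,1}^d` with isotone differences on comparable pairs,
every nonnegative spectator `r` and every profile `b`: `NK_b(G; r) ≤ NK_b(diag G; r)`, i.e.
`Σ_{arr b} G(x,y) r(z) ≤ Σ_{arr b} G(x,x) r(z)` — putting the two arguments of a Monge kernel on ONE copy beats splitting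
them over two (disjointly supported, negatively dependent) copies, arrangement class by arrangement class, whatever the third
copy does.  The rank-one case `G = f⊗g` (`f, g` monotone) is `N3_le_N3_mul`.  Proof: induction on `d` by `NK_cons`; the slice
step is `diagK_secK_cross_le`. [this work] -/
theorem NK_le_NK_diagK : ∀ (d : ℕ) (b : Fin d → ℕ) (G : Pt d → Pt d → ℝ) (r : Pt d → ℝ), IsMonge G →
    (∀ z, 0 ≤ r z) → NK b G r ≤ NK b (diagK G) r := by
  intro d
  induction d with
  | zero =>
    intro b G r _ _
    rw [NK_dim_zero, NK_dim_zero]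
    rfl
  | succ d ih =>
    intro b G r hG hr
    have hb : b = Fin.cons (b 0) (Fin.tail b) := (Fin.cons_self_tail b).symm
    set b' := Fin.tail b
    have sr := sec_nonneg hr
    have IH : ∀ (ε₁ ε₂ ε₃ : Bool), NK b' (secK G ε₁ ε₂) (sec r ε₃) ≤ NK b' (diagK (secK G ε₁ ε₂)) (sec r ε₃) :=
      fun ε₁ ε₂ ε₃ => ih b' _ _ (isMonge_secK hG ε₁ ε₂) (sr ε₃)
    -- the slice step, integrated against a nonnegative spectator section
    have step : ∀ ε₃ : Bool, NK b' (diagK (secK G true false)) (sec r ε₃) + NK b' (diagK (secK G false true)) (sec r ε₃) ≤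
        NK b' (diagK (secK G true true)) (sec r ε₃) + NK b' (diagK (secK G false false)) (sec r ε₃) := by
      intro ε₃
      rw [← NK_add, ← NK_add]
      exact NK_mono b' (fun x y => diagK_secK_cross_le hG x y) (sr ε₃)
    rw [hb]
    match hk : b 0 with
    | 0 =>
      rw [NK_cons_zero, NK_cons_zero, secK_diagK]
      exact IH false false false
    | 1 =>
      rw [NK_cons_one, NK_cons_one, secK_diagK, secK_diagK, secK_diagK]
      have h1 := IH true false false; have h2 := IH false true false; have h3 := IH false false true
      have hx := step false
      linarith
    | 2 =>
      rw [NK_cons_two, NK_cons_two, secK_diagK, secK_diagK, secK_diagK]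
      have h1 := IH false true true; have h2 := IH true false true; have h3 := IH true true false
      have hx := step true
      linarith
    | 3 =>
      rw [NK_cons_three, NK_cons_three, secK_diagK]
      exact IH true true true
    | k + 4 =>
      rw [NK_cons_add_four, NK_cons_add_four]

/-- Kernel Harris with the diagonal taken in the SECOND variable: `NK_b(G; r) ≤ NK_b(diag' G; r)`. [this work] -/
theorem NK_le_NK_diagK' (b : Fin d → ℕ) {G : Pt d → Pt d → ℝ} {r : Pt d → ℝ} (hG : IsMonge G) (hr : ∀ z, 0 ≤ r z) :
    NK b G r ≤ NK b (diagK' G) r := by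
  rw [diagK'_eq, NK_transK, ← NK_transK b G r]
  exact NK_le_NK_diagK d b _ r (isMonge_transK hG) hr

/-- Symmetric form: `2·NK_b(G; r) ≤ NK_b(diag G; r) + NK_b(diag' G; r)` — coefficientwise
`2·E G(X,Y) ≤ E G(X,X) + E G(Y,Y)`. [this work] -/
theorem two_NK_le (b : Fin d → ℕ) {G : Pt d → Pt d → ℝ} {r : Pt d → ℝ} (hG : IsMonge G) (hr : ∀ z, 0 ≤ r z) :
    2 * NK b G r ≤ NK b (diagK G) r + NK b (diagK' G) r := by
  have h1 := NK_le_NK_diagK d b G r hG hr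
  have h2 := NK_le_NK_diagK' b hG hr
  linarith

/-- Named gap form: `0 ≤ NK_b(diag G; r) − NK_b(G; r)`. [this work] -/
theorem kernelHarris_nonneg (b : Fin d → ℕ) {G : Pt d → Pt d → ℝ} {r : Pt d → ℝ} (hG : IsMonge G) (hr : ∀ z, 0 ≤ r z) :
    0 ≤ NK b (diagK G) r - NK b G r :=
  sub_nonneg.2 (NK_le_NK_diagK d b G r hG hr)

/-! ### §4 Rank-one kernels: Harris without sign conditions, antitone pairs, mixed pairs -/

/-- `f⊗g` is Monge when `f, g` are both monotone (any signs). [this work] -/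
theorem isMonge_mul_of_monotone {f g : Pt d → ℝ} (hf : Monotone f) (hg : Monotone g) :
    IsMonge (fun x y => f x * g y) := by
  intro x x' hx y y' hy
  have := mul_nonneg (sub_nonneg.2 (hf hx)) (sub_nonneg.2 (hg hy))
  nlinarith

/-- `f⊗g` is Monge when `f, g` are both antitone. [this work] -/
theorem isMonge_mul_of_antitone {f g : Pt d → ℝ} (hf : Antitone f) (hg : Antitone g) :
    IsMonge (fun x y => f x * g y) := by
  intro x x' hx y y' hy
  have := mul_nonneg_of_nonpos_of_nonpos (sub_nonpos.2 (hf hx)) (sub_nonpos.2 (hg hy))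
  nlinarith

/-- `−f⊗g` is Monge when `f` is monotone and `g` antitone. [this work] -/
theorem isMonge_neg_mul_of_monotone_antitone {f g : Pt d → ℝ} (hf : Monotone f) (hg : Antitone g) :
    IsMonge (fun x y => -(f x * g y)) := by
  intro x x' hx y y' hy
  have := mul_nonpos_of_nonneg_of_nonpos (α := ℝ) (sub_nonneg.2 (hf hx)) (sub_nonpos.2 (hg hy))
  nlinarith

/-- **Three-copy Harris without sign conditions**: for monotone `f, g : {0,1}^d → ℝ` (ANY signs), nonnegative `r` and every
profile `b`, `N_b(f;g;r) ≤ N_b(fg;1;r)`.  (`N3_le_N3_mul` assumed `f, g ≥ 0`.) [this work] -/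
theorem N3_le_N3_mul_of_monotone (b : Fin d → ℕ) {f g r : Pt d → ℝ} (hf : Monotone f) (hg : Monotone g)
    (hr : ∀ z, 0 ≤ r z) : N3 b f g r ≤ N3 b (f * g) 1 r := by
  rw [N3_eq_NK, N3_mul_one_eq_NK]
  exact NK_le_NK_diagK d b _ r (isMonge_mul_of_monotone hf hg) hr

/-- Three-copy Harris for two ANTITONE functions: `N_b(f;g;r) ≤ N_b(fg;1;r)`. [this work] -/
theorem N3_le_N3_mul_of_antitone (b : Fin d → ℕ) {f g r : Pt d → ℝ} (hf : Antitone f) (hg : Antitone g)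
    (hr : ∀ z, 0 ≤ r z) : N3 b f g r ≤ N3 b (f * g) 1 r := by
  rw [N3_eq_NK, N3_mul_one_eq_NK]
  exact NK_le_NK_diagK d b _ r (isMonge_mul_of_antitone hf hg) hr

/-- The REVERSED three-copy inequality for a monotone/antitone pair: `N_b(fg;1;r) ≤ N_b(f;g;r)` (coefficientwise negative
correlation of an increasing and a decreasing function, with a free nonnegative spectator). [this work] -/
theorem N3_mul_le_N3_of_monotone_antitone (b : Fin d → ℕ) {f g r : Pt d → ℝ} (hf : Monotone f) (hg : Antitone g)
    (hr : ∀ z, 0 ≤ r z) : N3 b (f * g) 1 r ≤ N3 b f g r := by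
  have h := NK_le_NK_diagK d b _ r (isMonge_neg_mul_of_monotone_antitone hf hg) hr
  have e1 : NK b (fun x y => -(f x * g y)) r = -N3 b f g r := by
    rw [N3_eq_NK]; unfold NK
    simp only [← sum_neg_distrib]
    refine sum_congr rfl fun x _ => sum_congr rfl fun y _ => sum_congr rfl fun z _ => ?_
    split_ifs <;> simp
  have e2 : NK b (diagK fun x y => -(f x * g y)) r = -N3 b (f * g) 1 r := by
    rw [N3_mul_one_eq_NK]; unfold NK diagK
    simp only [← sum_neg_distrib]
    refine sum_congr rfl fun x _ => sum_congr rfl fun y _ => sum_congr rfl fun z _ => ?_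
    split_ifs <;> simp
  rw [e1, e2] at h
  linarith

end

end Summit.CriticalPhenomena.PercolationContinuityZ3.Theorems.SahiThreeCopy
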